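import Summits.BirchSwinnertonDyer.BirchSwinnertonDyer.Theorems.PrintCf2RubinValueTwoEllipticUnitsLocalTowerTwo
import HarnessLib

/-!
# The PRINCIPAL two-variable elliptic units `⟨e(𝔞)⟩ ∈ principalCoherentFamilies` with an unramified offset, and THE PRODUCT RULE
# `σ̃_𝔞·⟨e(𝔠)⟩ · ⟨e(𝔞)⟩^{N𝔠} = ⟨e(𝔞𝔠)⟩` / `σ̃_𝔞·⟨e(𝔠)⟩ = ⟨e(𝔞𝔠)⟩·(⟨e(𝔞)⟩⁻¹)^{N𝔠}` (de Shalit II.2.4 (ii), II.4.14, III.1.3; Serre II §4 Prop. 8)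

Cell `bsd-print-cf2`, width seat `bsd-line-cf2c-w7` g15, route C `PrintCf2RubinValueTwo`, crux of record stmt-BirchSwinnertonDyer-24033
`TwoVariableMainConjAtSplitTwoQuad` (23720 nominal), BRICK §4(c); `--supports` the crux as a helper.  Sequel of
`PrintCf2RubinValueTwoEllipticUnitsLocalTowerTwo` (`ellipticUnitsLocal₂ = ofGlobal₂` of a two-variable theta family, its baseNorm-coherence and
the raw product rule).  THEOREMS + one definition by composition; CONDITIONAL on the published named facts `DeShalit1987.prop24_ii_galoisAction`,
`prop24_iii_unit`, `prop25_i_normRelation` where stated (hypotheses, never asserted).  Theses-free.  BSD is not proved by any of this.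

* ★★ `ellipticUnitsPrincipal₂` — **`⟨e(𝔞)⟩ := extendDown_c ⟨ofGlobal₂ x⟩ ∈ principalCoherentFamilies hπ E hmono`** (levelwise Teichmüller
  decomposition `LubinTateRelNormCoherentUnitsPrincipalPart`; the global level `i` — modulus `𝔤v'^{i+1}` — sits at the local unramified level
  `i + c`, `E_{i+c} ⊇ K(𝔤v'^{i+1})_𝔓`, and the levels `j < c` are reached by norms) — `ellipticUnitsPrincipal₂_mem_principalCoherentFamilies`:
  INPUT (i) of the (c)-capstone `ColemanCoinvariantArtin.charIdeal_coinvariants_colemanImage_closure_eq_span_of_mul_rule` for the elliptic units;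
* ★★★ `galAct_ellipticUnitsPrincipal₂_mul_pow` — **`σ̃·⟨e(𝔠)⟩_j · ⟨e(𝔞)⟩_j^{N𝔠} = ⟨e(𝔞𝔠)⟩_j`** at every level `j`, for every `σ̃ ∈ Γ_{K_v}`
  restricting to the Artin symbols of `𝔞` (the principal projection and `extendDown` are `Γ_{K_v}`-equivariant monoid maps);
  ★★ `galAct_ellipticUnitsPrincipal₂_eq` — the `hrule` shape `σ̃_𝔞·β_𝔠 = β_{𝔞𝔠}·(β_𝔞⁻¹)^{N𝔠}` of the capstone VERBATIM (INPUT (ii)(R)).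

What remains for the capstone (not here): the index set of ideals whose Artin symbol lies in the decomposition group of `𝔓` (existence of the
lifts `σ̃_𝔞`), the layer-approximation (Artin surjectivity + density), the indices `a₁`/`a₂`, and `L_ε ≠ 0`.

## References
* [deShalit1987] E. de Shalit, *Iwasawa theory of elliptic curves with complex multiplication* (1987), II.2.4 (ii), II.4.12 (p. 66), II.4.14 (p. 71),
  Ch. I §3.8 (16)–(17), III.1.2–1.3 (p. 89–90).
* [SerreLocalFields1979] J.-P. Serre, *Local Fields* (1979), Ch. II §4 Prop. 8.
-/

-- the summit namespace `Summit.BirchSwinnertonDyer.BirchSwinnertonDyer` repeats the problem name by design (D-0017)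
set_option linter.dupNamespace false
set_option autoImplicit false

noncomputable section

open scoped Classical
open scoped NumberField
open Field IsDedekindDomain IsDedekindDomain.HeightOneSpectrum ValuativeRel
open Literature.NumberTheory.NumberFields
open Literature.NumberTheory.GaloisRepresentations Literature.NumberTheory.GaloisRepresentations.IsNonarchimedeanLocalField
  Literature.NumberTheory.GaloisRepresentations.LubinTate Literature.NumberTheory.GaloisRepresentations.ArtinLocalGlobal
open Literature.NumberTheory.EllipticCurves
open Literature.NumberTheory.ComplexMultiplication.EllipticUnits
open Literature.NumberTheory.LFunctions.AbelianDensity (artinSymbol)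
open Summit.BirchSwinnertonDyer.BirchSwinnertonDyer.Theorems.PrintCf2.EllipticUnitsLocal

namespace Summit.BirchSwinnertonDyer.BirchSwinnertonDyer.Theorems.PrintCf2.EllipticUnitsLocal₂

variable {K : Type} [Field K] [NumberField K] {𝔤 : Ideal (𝓞 K)} {v v' : HeightOneSpectrum (𝓞 K)}

attribute [local instance] ltNormUniformSpace ltNormIsUniformAddGroup rk1 nF nE fintypeResidueField

/-! ## The principal projection with an unramified offset: `⟨e(𝔞)⟩ ∈ principalCoherentFamilies` and its product rule -/

section Principal

attribute [local instance] RelNormCoherentUnits.instCommMonoid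

variable [NumberField.IsTotallyComplex K]
  (h24iii : DeShalit1987.prop24_iii_unit) (h25 : DeShalit1987.prop25_i_normRelation) (hK : IsImaginaryQuadratic K) (ι : K →+* ℂ)
  (h𝔤0 : 𝔤 ≠ ⊥) (hv : ¬ 𝔤 ≤ v.asIdeal) (hvv' : v' ≠ v) (hw : ∀ u : (𝓞 K)ˣ, (u : 𝓞 K) - 1 ∈ 𝔤 * v'.asIdeal → u = 1)
  {π : 𝒪[v.adicCompletion K]} (hπ : (valuation (v.adicCompletion K)).IsUniformizer (π : v.adicCompletion K))
  {α : ℕ → 𝓞 K} (hα0 : ∀ i, α i ≠ 0) (hα𝔪 : ∀ i, α i - 1 ∈ 𝔤 * v'.asIdeal ^ (i + 1))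
  (hαw : ∀ i, ∀ w : HeightOneSpectrum (𝓞 K), w ≠ v → α i ∉ w.asIdeal)
  {f : ℕ → ℕ} (hαπ : ∀ i, ((α i : K) : v.adicCompletion K) = (π : v.adicCompletion K) ^ f i)
  [CharZero (v.adicCompletion K)]
  (E : ℕ → IntermediateField (v.adicCompletion K) (AlgebraicClosure (v.adicCompletion K)))
  [∀ j, FiniteDimensional (v.adicCompletion K) (E j)] [∀ j, IsGalois (v.adicCompletion K) (E j)]
  (hmono : Monotone E) (c : ℕ) (hE : ∀ i, E (i + c) ≤ maxUnramified (v.adicCompletion K))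
  (hdegE : ∀ i, ∀ w : WeilGroup (v.adicCompletion K),
    WeilGroup.toAbsGalois (v.adicCompletion K) w ∈ (E (i + c)).fixingSubgroup → (f i : ℤ) ∣ WeilGroup.deg w)
  {𝔞 : Ideal (𝓞 K)} (h𝔞0 : 𝔞 ≠ ⊥) (h𝔞c : IsCoprime 𝔞 (𝔤 * v.asIdeal * v'.asIdeal))

include h24iii h25 hK hvv' h𝔞0 h𝔞c in
/-- ★★ **`⟨e(𝔞)⟩` — THE PRINCIPAL COHERENT TWO-VARIABLE ELLIPTIC UNITS**: the global level `i` (modulus `𝔤v'^{i+1}`) sits at the local unramified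
level `i + c` (`E_{i+c} ⊇ K(𝔤v'^{i+1})_𝔓`); `⟨e(𝔞)⟩ := extendDown_c (⟨ofGlobal₂ x⟩)` — principal projection (levelwise Teichmüller decomposition)
and norms down to the levels `j < c`. [cite: deShalit1987, Ch. I §3.8 (16)–(17), II.4.14 (p. 71), III.1.3 (p. 90)] [cite: SerreLocalFields1979, Ch. II §4 Prop. 8] -/
def ellipticUnitsPrincipal₂ (x : ∀ i k : ℕ, rayClassField K (𝔤 * v'.asIdeal ^ (i + 1) * v.asIdeal ^ (k + 1)))
    (hx : ∀ i k : ℕ, IsThetaValueOne ι (𝔤 * v'.asIdeal ^ (i + 1) * v.asIdeal ^ (k + 1)) 𝔞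
      (algClosureEmb ι ((x i k : rayClassField K (𝔤 * v'.asIdeal ^ (i + 1) * v.asIdeal ^ (k + 1))) : AlgebraicClosure K))) :
    ∀ j, RelNormCoherentUnits hπ (E j) :=
  extendDown hπ E hmono c fun i ↦
    (ellipticUnitsLocal₂ h24iii h25 hK ι h𝔤0 hv hvv' hw hπ hα0 hα𝔪 hαw hαπ (fun i ↦ E (i + c)) hE hdegE h𝔞0 h𝔞c x hx i).principalPart

variable
  (hinert : ∀ i, ∀ τ : absoluteGaloisGroup (v.adicCompletion K),
    (∀ y ∈ rayClassField K (𝔤 * v'.asIdeal ^ (i + 1 + 1)),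
      τ • absClosureEmbedding K (v.adicCompletion K) y = absClosureEmbedding K (v.adicCompletion K) y) →
      τ ∈ (E (i + 1 + c)).fixingSubgroup)
  (hcount : ∀ i k : ℕ, IntermediateField.relfinrank (rayClassField K (𝔤 * v'.asIdeal ^ (i + 1) * v.asIdeal ^ (k + 1)))
      (rayClassField K (𝔤 * v'.asIdeal ^ (i + 1 + 1) * v.asIdeal ^ (k + 1))) * Module.finrank (v.adicCompletion K) (E (i + c)) ≤
      Module.finrank (v.adicCompletion K) (E (i + 1 + c)))

include hinert hcount in
/-- ★★ **`⟨e(𝔞)⟩ ∈ principalCoherentFamilies hπ E hmono`** — input (i) of the (c)-capstone for the elliptic units.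
[cite: deShalit1987, Ch. I §3.8 (16)–(17), II.4.14 (p. 71), III.1.1–1.3 (p. 88–90)] [cite: SerreLocalFields1979, Ch. II §4 Prop. 8] -/
theorem ellipticUnitsPrincipal₂_mem_principalCoherentFamilies
    (x : ∀ i k : ℕ, rayClassField K (𝔤 * v'.asIdeal ^ (i + 1) * v.asIdeal ^ (k + 1)))
    (hx : ∀ i k : ℕ, IsThetaValueOne ι (𝔤 * v'.asIdeal ^ (i + 1) * v.asIdeal ^ (k + 1)) 𝔞
      (algClosureEmb ι ((x i k : rayClassField K (𝔤 * v'.asIdeal ^ (i + 1) * v.asIdeal ^ (k + 1))) : AlgebraicClosure K))) :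
    ellipticUnitsPrincipal₂ h24iii h25 hK ι h𝔤0 hv hvv' hw hπ hα0 hα𝔪 hαw hαπ E hmono c hE hdegE h𝔞0 h𝔞c x hx ∈
      principalCoherentFamilies hπ E hmono :=
  extendDown_principalPart_mem_principalCoherentFamilies hπ E hmono c
    (ellipticUnitsLocal₂_mem_coherentFamilies h24iii h25 hK ι h𝔤0 hv hvv' hw hπ hα0 hα𝔪 hαw hαπ (fun i ↦ E (i + c))
      (monotone_shift E hmono c) hE hdegE h𝔞0 h𝔞c hinert hcount x hx)

omit [NumberField.IsTotallyComplex K] [CharZero (v.adicCompletion K)] in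
/-- `N_{E₂/E₁}(ββ') = N(β)N(β')` (monoid form). [cite: deShalit1987, Ch. III §1.2 Lemma (ii)] -/
private theorem baseNorm_mul' {E₁ E₂ : IntermediateField (v.adicCompletion K) (AlgebraicClosure (v.adicCompletion K))}
    [FiniteDimensional (v.adicCompletion K) E₁] [FiniteDimensional (v.adicCompletion K) E₂] [IsGalois (v.adicCompletion K) E₂]
    (h : E₁ ≤ E₂) (β β' : RelNormCoherentUnits hπ E₂) : (β * β').baseNorm hπ h = β.baseNorm hπ h * β'.baseNorm hπ h :=
  RelNormCoherentUnits.baseNorm_mul hπ h β β'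

omit [NumberField.IsTotallyComplex K] [CharZero (v.adicCompletion K)] in
/-- `N_{E₂/E₁}` commutes with powers. [cite: deShalit1987, Ch. III §1.2 Lemma (ii)] -/
private theorem baseNorm_pow {E₁ E₂ : IntermediateField (v.adicCompletion K) (AlgebraicClosure (v.adicCompletion K))}
    [FiniteDimensional (v.adicCompletion K) E₁] [FiniteDimensional (v.adicCompletion K) E₂] [IsGalois (v.adicCompletion K) E₂]
    (h : E₁ ≤ E₂) (β : RelNormCoherentUnits hπ E₂) (n : ℕ) : (β ^ n).baseNorm hπ h = β.baseNorm hπ h ^ n := by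
  induction n with
  | zero => rw [pow_zero, pow_zero]; exact RelNormCoherentUnits.baseNorm_one hπ h
  | succ n ih => rw [pow_succ, pow_succ, ← ih]; exact RelNormCoherentUnits.baseNorm_mul hπ h _ _

omit [NumberField.IsTotallyComplex K] in
/-- `⟨ββ'⟩ = ⟨β⟩⟨β'⟩` (monoid form). [cite: SerreLocalFields1979, Ch. II §4 Prop. 8] -/
private theorem principalPart_mul' {E₀ : IntermediateField (v.adicCompletion K) (AlgebraicClosure (v.adicCompletion K))}
    [FiniteDimensional (v.adicCompletion K) E₀] [IsGalois (v.adicCompletion K) E₀] (β β' : RelNormCoherentUnits hπ E₀) :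
    (β * β').principalPart = β.principalPart * β'.principalPart :=
  RelNormCoherentUnits.principalPart_mul β β'

omit [NumberField.IsTotallyComplex K] in
/-- `⟨β^n⟩ = ⟨β⟩^n`. [cite: SerreLocalFields1979, Ch. II §4 Prop. 8] -/
private theorem principalPart_pow {E₀ : IntermediateField (v.adicCompletion K) (AlgebraicClosure (v.adicCompletion K))}
    [FiniteDimensional (v.adicCompletion K) E₀] [IsGalois (v.adicCompletion K) E₀] (β : RelNormCoherentUnits hπ E₀) (n : ℕ) :
    (β ^ n).principalPart = β.principalPart ^ n := by
  induction n with
  | zero => rw [pow_zero, pow_zero]; exact RelNormCoherentUnits.principalPart_one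
  | succ n ih => rw [pow_succ, pow_succ, ← ih]; exact RelNormCoherentUnits.principalPart_mul _ _

variable (h24ii : DeShalit1987.prop24_ii_galoisAction)
  {𝔠 : Ideal (𝓞 K)} (h𝔠0 : 𝔠 ≠ ⊥) (h𝔠c : IsCoprime 𝔠 (𝔤 * v.asIdeal * v'.asIdeal))
  (h𝔞𝔠c : IsCoprime (𝔞 * 𝔠) (𝔤 * v.asIdeal * v'.asIdeal))

include h24ii in
/-- ★★★ **THE PRODUCT RULE for the principal families**: `σ̃·⟨e(𝔠)⟩ · ⟨e(𝔞)⟩^{N𝔠} = ⟨e(𝔞𝔠)⟩` in `∏_j 𝒰(E_j·K_π^∞)` for every `σ̃ ∈ Γ_{K_v}`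
restricting to the Artin symbols of `𝔞` (the principal projection and `extendDown` are `Γ_{K_v}`-equivariant monoid maps).
[cite: deShalit1987, II.2.4 Proposition (ii), II.4.12 (p. 66), II.4.14 (p. 71)] [cite: SerreLocalFields1979, Ch. II §4 Prop. 8] -/
theorem galAct_ellipticUnitsPrincipal₂_mul_pow
    (xa : ∀ i k : ℕ, rayClassField K (𝔤 * v'.asIdeal ^ (i + 1) * v.asIdeal ^ (k + 1)))
    (hxa : ∀ i k : ℕ, IsThetaValueOne ι (𝔤 * v'.asIdeal ^ (i + 1) * v.asIdeal ^ (k + 1)) 𝔞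
      (algClosureEmb ι ((xa i k : rayClassField K (𝔤 * v'.asIdeal ^ (i + 1) * v.asIdeal ^ (k + 1))) : AlgebraicClosure K)))
    (xc : ∀ i k : ℕ, rayClassField K (𝔤 * v'.asIdeal ^ (i + 1) * v.asIdeal ^ (k + 1)))
    (hxc : ∀ i k : ℕ, IsThetaValueOne ι (𝔤 * v'.asIdeal ^ (i + 1) * v.asIdeal ^ (k + 1)) 𝔠
      (algClosureEmb ι ((xc i k : rayClassField K (𝔤 * v'.asIdeal ^ (i + 1) * v.asIdeal ^ (k + 1))) : AlgebraicClosure K)))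
    (xac : ∀ i k : ℕ, rayClassField K (𝔤 * v'.asIdeal ^ (i + 1) * v.asIdeal ^ (k + 1)))
    (hxac : ∀ i k : ℕ, IsThetaValueOne ι (𝔤 * v'.asIdeal ^ (i + 1) * v.asIdeal ^ (k + 1)) (𝔞 * 𝔠)
      (algClosureEmb ι ((xac i k : rayClassField K (𝔤 * v'.asIdeal ^ (i + 1) * v.asIdeal ^ (k + 1))) : AlgebraicClosure K)))
    (σ : absoluteGaloisGroup (v.adicCompletion K))
    (hσ : ∀ i k : ℕ, absRestrictNormalHom (rayClassField K (𝔤 * v'.asIdeal ^ (i + 1) * v.asIdeal ^ (k + 1)))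
        (absGaloisRestrict K (v.adicCompletion K) σ) =
      artinSymbol (galFrob K (rayClassField K (𝔤 * v'.asIdeal ^ (i + 1) * v.asIdeal ^ (k + 1)))) 𝔞)
    (j : ℕ) :
    (ellipticUnitsPrincipal₂ h24iii h25 hK ι h𝔤0 hv hvv' hw hπ hα0 hα𝔪 hαw hαπ E hmono c hE hdegE h𝔠0 h𝔠c xc hxc j).galAct σ *
        ellipticUnitsPrincipal₂ h24iii h25 hK ι h𝔤0 hv hvv' hw hπ hα0 hα𝔪 hαw hαπ E hmono c hE hdegE h𝔞0 h𝔞c xa hxa j ^ Ideal.absNorm 𝔠 =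
      ellipticUnitsPrincipal₂ h24iii h25 hK ι h𝔤0 hv hvv' hw hπ hα0 hα𝔪 hαw hαπ E hmono c hE hdegE (mul_ne_zero h𝔞0 h𝔠0) h𝔞𝔠c xac hxac j := by
  have hi := galAct_ellipticUnitsLocal₂_mul_pow h24iii h25 hK ι h𝔤0 hv hvv' hw hπ hα0 hα𝔪 hαw hαπ (fun i ↦ E (i + c)) hE hdegE h𝔞0 h𝔞c
    h24ii h𝔠0 h𝔠c h𝔞𝔠c xa hxa xc hxc xac hxac σ hσ (j - c)
  unfold ellipticUnitsPrincipal₂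
  rw [extendDown_apply, extendDown_apply, extendDown_apply]
  rw [← RelNormCoherentUnits.baseNorm_galAct, ← baseNorm_pow, ← baseNorm_mul', ← RelNormCoherentUnits.principalPart_galAct,
    ← principalPart_pow, ← principalPart_mul', hi]

include h24ii in
/-- ★ **The `hrule` of the (c)-capstone, verbatim shape**: `σ̃_𝔞·⟨e(𝔠)⟩ = ⟨e(𝔞𝔠)⟩ · (⟨e(𝔞)⟩⁻¹)^{N𝔠}`.
[cite: deShalit1987, II.2.4 Proposition (ii), II.4.12 (p. 66)] -/
theorem galAct_ellipticUnitsPrincipal₂_eq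
    (xa : ∀ i k : ℕ, rayClassField K (𝔤 * v'.asIdeal ^ (i + 1) * v.asIdeal ^ (k + 1)))
    (hxa : ∀ i k : ℕ, IsThetaValueOne ι (𝔤 * v'.asIdeal ^ (i + 1) * v.asIdeal ^ (k + 1)) 𝔞
      (algClosureEmb ι ((xa i k : rayClassField K (𝔤 * v'.asIdeal ^ (i + 1) * v.asIdeal ^ (k + 1))) : AlgebraicClosure K)))
    (xc : ∀ i k : ℕ, rayClassField K (𝔤 * v'.asIdeal ^ (i + 1) * v.asIdeal ^ (k + 1)))
    (hxc : ∀ i k : ℕ, IsThetaValueOne ι (𝔤 * v'.asIdeal ^ (i + 1) * v.asIdeal ^ (k + 1)) 𝔠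
      (algClosureEmb ι ((xc i k : rayClassField K (𝔤 * v'.asIdeal ^ (i + 1) * v.asIdeal ^ (k + 1))) : AlgebraicClosure K)))
    (xac : ∀ i k : ℕ, rayClassField K (𝔤 * v'.asIdeal ^ (i + 1) * v.asIdeal ^ (k + 1)))
    (hxac : ∀ i k : ℕ, IsThetaValueOne ι (𝔤 * v'.asIdeal ^ (i + 1) * v.asIdeal ^ (k + 1)) (𝔞 * 𝔠)
      (algClosureEmb ι ((xac i k : rayClassField K (𝔤 * v'.asIdeal ^ (i + 1) * v.asIdeal ^ (k + 1))) : AlgebraicClosure K)))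
    (σ : absoluteGaloisGroup (v.adicCompletion K))
    (hσ : ∀ i k : ℕ, absRestrictNormalHom (rayClassField K (𝔤 * v'.asIdeal ^ (i + 1) * v.asIdeal ^ (k + 1)))
        (absGaloisRestrict K (v.adicCompletion K) σ) =
      artinSymbol (galFrob K (rayClassField K (𝔤 * v'.asIdeal ^ (i + 1) * v.asIdeal ^ (k + 1)))) 𝔞) :
    (fun j ↦ (ellipticUnitsPrincipal₂ h24iii h25 hK ι h𝔤0 hv hvv' hw hπ hα0 hα𝔪 hαw hαπ E hmono c hE hdegE h𝔠0 h𝔠c xc hxc j).galAct σ) =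
      ellipticUnitsPrincipal₂ h24iii h25 hK ι h𝔤0 hv hvv' hw hπ hα0 hα𝔪 hαw hαπ E hmono c hE hdegE (mul_ne_zero h𝔞0 h𝔠0) h𝔞𝔠c xac hxac *
        (fun j ↦ (ellipticUnitsPrincipal₂ h24iii h25 hK ι h𝔤0 hv hvv' hw hπ hα0 hα𝔪 hαw hαπ E hmono c hE hdegE h𝔞0 h𝔞c xa hxa j).inv hπ
          (E j)) ^ Ideal.absNorm 𝔠 := by
  have h : (fun j ↦ (ellipticUnitsPrincipal₂ h24iii h25 hK ι h𝔤0 hv hvv' hw hπ hα0 hα𝔪 hαw hαπ E hmono c hE hdegE h𝔠0 h𝔠c xc hxc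
        j).galAct σ) *
      ellipticUnitsPrincipal₂ h24iii h25 hK ι h𝔤0 hv hvv' hw hπ hα0 hα𝔪 hαw hαπ E hmono c hE hdegE h𝔞0 h𝔞c xa hxa ^ Ideal.absNorm 𝔠 =
      ellipticUnitsPrincipal₂ h24iii h25 hK ι h𝔤0 hv hvv' hw hπ hα0 hα𝔪 hαw hαπ E hmono c hE hdegE (mul_ne_zero h𝔞0 h𝔠0) h𝔞𝔠c xac hxac :=
    funext fun j ↦ galAct_ellipticUnitsPrincipal₂_mul_pow h24iii h25 hK ι h𝔤0 hv hvv' hw hπ hα0 hα𝔪 hαw hαπ E hmono c hE hdegE h𝔞0 h𝔞c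
      h24ii h𝔠0 h𝔠c h𝔞𝔠c xa hxa xc hxc xac hxac σ hσ j
  set A := fun j ↦ (ellipticUnitsPrincipal₂ h24iii h25 hK ι h𝔤0 hv hvv' hw hπ hα0 hα𝔪 hαw hαπ E hmono c hE hdegE h𝔠0 h𝔠c xc hxc j).galAct σ
  set B := ellipticUnitsPrincipal₂ h24iii h25 hK ι h𝔤0 hv hvv' hw hπ hα0 hα𝔪 hαw hαπ E hmono c hE hdegE h𝔞0 h𝔞c xa hxa
  set B' := fun j ↦ (ellipticUnitsPrincipal₂ h24iii h25 hK ι h𝔤0 hv hvv' hw hπ hα0 hα𝔪 hαw hαπ E hmono c hE hdegE h𝔞0 h𝔞c xa hxa j).inv hπ (E j)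
  have hB : B * B' = 1 := funext fun j ↦ RelNormCoherentUnits.mul_inv hπ (E j) (B j)
  calc A = A * (B * B') ^ Ideal.absNorm 𝔠 := by rw [hB, one_pow, mul_one]
    _ = A * B ^ Ideal.absNorm 𝔠 * B' ^ Ideal.absNorm 𝔠 := by rw [mul_pow, mul_assoc]
    _ = _ := by rw [h]

end Principal

end Summit.BirchSwinnertonDyer.BirchSwinnertonDyer.Theorems.PrintCf2.EllipticUnitsLocal₂

end
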